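import Summits.KontsevichZagierPeriods.KontsevichZagierPeriods.Theorems.FurushoPentagonStuffleInKZDefs

/-!
# `StuffleInKZ` (stmt-KontsevichZagierPeriods-3931, route `FurushoPentagon`) — line
`cumulative-cube-lattice-paths`: the cube kernel identity (stub `stub_kernelStuffle`)

On the product cube the product of the two cube kernels is the sum, over the lattice paths
`p ∈ paths |s| |t|`, of the path kernels:
`cubeKernel s xs · cubeKernel t ys = Σ_p pathKernel s t p xs ys`
(Soudères 2010, Prop. 1.5; Markarian 2020, Prop. 2).  It is the instance
`A i = (xs.take (s₁+⋯+sᵢ)).prod`, `B j = (ys.take (t₁+⋯+t_j)).prod` of an identity in `ℚ(A, B)`: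
for `A 0 = B 0 = 1` and `A i · B j ≠ 1` off the origin (`i ≤ k`, `j ≤ l`),
`(∏_{m<k} A m/(1 − A(m+1))) · (∏_{m<l} B m/(1 − B(m+1))) = Σ_{p ∈ paths k l} ∏_{m<|p|} N_p m/(1 − N_p(m+1))`
with `N_p m = A (cx (p.take m)) · B (cy (p.take m))`, proved by the LAST-STEP recursion of the
lattice paths (taken as a hypothesis, together with the endpoint count), the tail formula
`T (p ++ [σ]) = T p · N_{|p|}/(1 − N_{|p|+1})` and the partial fraction
`1 − αβ = β(1 − α) + α(1 − β) + (1 − α)(1 − β)`.  On the open cube every partial product with at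
least one factor lies in `(0,1)`, which gives the non-degeneracy `A i · B j ≠ 1`.

References: I. Soudères, *Motivic double shuffle*, IJNT 6 (2010) §1.3 Prop. 1.5; N. Markarian,
arXiv:2008.00855, Prop. 2; M. Hoffman, J. Algebra 194 (1997) §2.
-/

noncomputable section

namespace Summit.KontsevichZagierPeriods.FurushoPentagon.StuffleInKZ

open Literature.NumberTheory.Transcendental
open Literature.NumberTheory.Transcendental.MZV (weight)

/-! ### The straight paths -/

/-- The all-`Y` path consumes no entry of `s`. [folklore] -/
theorem cx_replicate_Y (l : ℕ) : cx (List.replicate l Step.Y) = 0 := by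
  induction l with
  | zero => rfl
  | succ l ih => rw [List.replicate_succ, cx_cons_Y, ih]

/-- The all-`Y` path of length `l` consumes `l` entries of `t`. [folklore] -/
theorem cy_replicate_Y (l : ℕ) : cy (List.replicate l Step.Y) = l := by
  induction l with
  | zero => rfl
  | succ l ih => rw [List.replicate_succ, cy_cons_Y, ih]

/-- The all-`X` path of length `k` consumes `k` entries of `s`. [folklore] -/
theorem cx_replicate_X (k : ℕ) : cx (List.replicate k Step.X) = k := by
  induction k with
  | zero => rfl
  | succ k ih => rw [List.replicate_succ, cx_cons_X, ih]

/-- The all-`X` path consumes no entry of `t`. [folklore] -/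
theorem cy_replicate_X (k : ℕ) : cy (List.replicate k Step.X) = 0 := by
  induction k with
  | zero => rfl
  | succ k ih => rw [List.replicate_succ, cy_cons_X, ih]

/-! ### The identity in `ℚ(A, B)` -/

section Abstract

variable (A B : ℕ → ℝ) (N : List Step → ℕ → ℝ) (T : List Step → ℝ)

/-- **Tail formula.** For the path products `T p = ∏_{m<|p|} N_p m/(1 − N_p(m+1))` with node
products `N_p m = A (cx (p.take m)) · B (cy (p.take m))`, appending one step multiplies by the
factor of the new last node: `T (p ++ [σ]) = T p · (A (cx p) B (cy p)) / (1 − A (cx (p++[σ])) B (cy (p++[σ])))`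
(the first `|p|` nodes of `p ++ [σ]` are those of `p`). [cite: Souderes2010, §1.3 Prop. 1.5] -/
theorem pathProd_append_singleton
    (hN : ∀ p m, N p m = A (cx (p.take m)) * B (cy (p.take m)))
    (hT : ∀ p, T p = ∏ m ∈ Finset.range p.length, N p m / (1 - N p (m + 1)))
    (p : List Step) (σ : Step) :
    T (p ++ [σ]) = T p * (A (cx p) * B (cy p) / (1 - A (cx (p ++ [σ])) * B (cy (p ++ [σ])))) := by
  rw [hT, hT p, List.length_append, List.length_singleton, Finset.prod_range_succ]
  congr 1
  · refine Finset.prod_congr rfl fun m hm => ?_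
    have hm : m < p.length := Finset.mem_range.mp hm
    rw [hN, hN, hN p m, hN p (m + 1), List.take_append_of_le_length (Nat.le_of_lt hm),
      List.take_append_of_le_length (Nat.succ_le_of_lt hm)]
  · rw [hN, hN, List.take_append_length, List.take_of_length_le (by simp)]

/-- **The kernel identity in `ℚ(A, B)`** (Soudères 2010 Prop. 1.5, Markarian 2020 Prop. 2, in
cumulative-product form).  Granted the endpoint count of the lattice paths and their last-step
decomposition up to permutation: for `A 0 = B 0 = 1` and `A i · B j ≠ 1` whenever `i ≤ k`, `j ≤ l`,
`(i, j) ≠ (0, 0)`,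
`(∏_{m<k} A m/(1 − A(m+1))) · (∏_{m<l} B m/(1 − B(m+1))) = Σ_{p ∈ paths k l} T p`.
Induction on `k`, then on `l`, through the last-step decomposition, the tail formula and the partial
fraction `1 − αβ = β(1 − α) + α(1 − β) + (1 − α)(1 − β)` (`α = A(k+1)`, `β = B(l+1)`).
[cite: Souderes2010, §1.3 Prop. 1.5] -/
theorem kernel_identity_abstract
    (hN : ∀ p m, N p m = A (cx (p.take m)) * B (cy (p.take m)))
    (hT : ∀ p, T p = ∏ m ∈ Finset.range p.length, N p m / (1 - N p (m + 1)))
    (hA0 : A 0 = 1) (hB0 : B 0 = 1)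
    (H1 : ∀ (k l : ℕ) (p : List Step), p ∈ paths k l → cx p = k ∧ cy p = l)
    (H2 : ∀ k l : ℕ, (paths (k + 1) (l + 1)).Perm
      ((paths k (l + 1)).map (· ++ [Step.X]) ++
        ((paths (k + 1) l).map (· ++ [Step.Y]) ++ (paths k l).map (· ++ [Step.D])))) :
    ∀ k l : ℕ, (∀ i j : ℕ, i ≤ k → j ≤ l → (i ≠ 0 ∨ j ≠ 0) → A i * B j ≠ 1) →
      (∏ m ∈ Finset.range k, A m / (1 - A (m + 1))) *
          (∏ m ∈ Finset.range l, B m / (1 - B (m + 1))) = ((paths k l).map T).sum := by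
  have tail := pathProd_append_singleton A B N T hN hT
  -- the straight paths
  have hY : ∀ l, T (List.replicate l Step.Y) = ∏ m ∈ Finset.range l, B m / (1 - B (m + 1)) := by
    intro l
    induction l with
    | zero => rw [hT, List.length_replicate, Finset.prod_range_zero, Finset.prod_range_zero]
    | succ l ih =>
      rw [List.replicate_succ', tail, ih, Finset.prod_range_succ, cx_append, cy_append,
        cx_replicate_Y, cy_replicate_Y]
      simp [hA0]
  have hX : ∀ k, T (List.replicate k Step.X) = ∏ m ∈ Finset.range k, A m / (1 - A (m + 1)) := by
    intro k
    induction k with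
    | zero => rw [hT, List.length_replicate, Finset.prod_range_zero, Finset.prod_range_zero]
    | succ k ih =>
      rw [List.replicate_succ', tail, ih, Finset.prod_range_succ, cx_append, cy_append,
        cx_replicate_X, cy_replicate_X]
      simp [hB0]
  intro k
  induction k with
  | zero =>
    intro l _
    rw [paths_zero_left, List.map_cons, List.map_nil, List.sum_cons, List.sum_nil, add_zero, hY,
      Finset.prod_range_zero, one_mul]
  | succ k ihk =>
    intro l
    induction l with
    | zero =>
      intro _
      rw [paths_succ_zero, List.map_cons, List.map_nil, List.sum_cons, List.sum_nil, add_zero, hX,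
        Finset.prod_range_zero, mul_one]
    | succ l ihl =>
      intro hne
      have IH1 := ihk (l + 1) fun i j hi hj h => hne i j (Nat.le_succ_of_le hi) hj h
      have IH2 := ihl fun i j hi hj h => hne i j hi (Nat.le_succ_of_le hj) h
      have IH3 := ihk l fun i j hi hj h => hne i j (Nat.le_succ_of_le hi) (Nat.le_succ_of_le hj) h
      have hα : 1 - A (k + 1) ≠ 0 := by
        have h := hne (k + 1) 0 le_rfl (Nat.zero_le _) (Or.inl (Nat.succ_ne_zero k))
        rw [hB0, mul_one] at h
        exact sub_ne_zero.mpr (Ne.symm h)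
      have hβ : 1 - B (l + 1) ≠ 0 := by
        have h := hne 0 (l + 1) (Nat.zero_le _) le_rfl (Or.inr (Nat.succ_ne_zero l))
        rw [hA0, one_mul] at h
        exact sub_ne_zero.mpr (Ne.symm h)
      have hαβ : 1 - A (k + 1) * B (l + 1) ≠ 0 :=
        sub_ne_zero.mpr (Ne.symm (hne (k + 1) (l + 1) le_rfl le_rfl (Or.inl (Nat.succ_ne_zero k))))
      -- the three blocks of the last-step decomposition, factored through the tail formula
      have blockX : ((paths k (l + 1)).map (T ∘ (· ++ [Step.X]))).sum =
          ((paths k (l + 1)).map T).sum * (A k * B (l + 1) / (1 - A (k + 1) * B (l + 1))) := by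
        rw [← List.sum_map_mul_right]
        refine congrArg List.sum (List.map_congr_left fun p hp => ?_)
        obtain ⟨hcx, hcy⟩ := H1 k (l + 1) p hp
        rw [Function.comp_apply, tail, cx_append, cy_append, hcx, hcy]
        simp
      have blockY : ((paths (k + 1) l).map (T ∘ (· ++ [Step.Y]))).sum =
          ((paths (k + 1) l).map T).sum * (A (k + 1) * B l / (1 - A (k + 1) * B (l + 1))) := by
        rw [← List.sum_map_mul_right]
        refine congrArg List.sum (List.map_congr_left fun p hp => ?_)
        obtain ⟨hcx, hcy⟩ := H1 (k + 1) l p hp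
        rw [Function.comp_apply, tail, cx_append, cy_append, hcx, hcy]
        simp
      have blockD : ((paths k l).map (T ∘ (· ++ [Step.D]))).sum =
          ((paths k l).map T).sum * (A k * B l / (1 - A (k + 1) * B (l + 1))) := by
        rw [← List.sum_map_mul_right]
        refine congrArg List.sum (List.map_congr_left fun p hp => ?_)
        obtain ⟨hcx, hcy⟩ := H1 k l p hp
        rw [Function.comp_apply, tail, cx_append, cy_append, hcx, hcy]
        simp
      rw [((H2 k l).map T).sum_eq, List.map_append, List.map_append, List.sum_append,
        List.sum_append, List.map_map, List.map_map, List.map_map, blockX, blockY, blockD, ← IH1,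
        ← IH2, ← IH3, Finset.prod_range_succ, Finset.prod_range_succ]
      generalize (∏ m ∈ Finset.range k, A m / (1 - A (m + 1))) = PA
      generalize (∏ m ∈ Finset.range l, B m / (1 - B (m + 1))) = PB
      field_simp
      ring

end Abstract

/-! ### Partial products on the open cube -/

/-- A product of reals in `(0,1)` lies in `(0,1]`, and in `(0,1)` as soon as there is a factor.
[folklore] -/
theorem prod_pos_le_one_of_forall_mem_Ioo {ws : List ℝ} (h : ∀ w ∈ ws, w ∈ Set.Ioo (0 : ℝ) 1) :
    0 < ws.prod ∧ ws.prod ≤ 1 ∧ (ws ≠ [] → ws.prod < 1) := by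
  induction ws with
  | nil => simp
  | cons a ws ih =>
    obtain ⟨ha0, ha1⟩ := h a List.mem_cons_self
    obtain ⟨ih0, ih1, -⟩ := ih fun w hw => h w (List.mem_cons_of_mem a hw)
    refine ⟨?_, ?_, fun _ => ?_⟩
    · rw [List.prod_cons]; exact mul_pos ha0 ih0
    · rw [List.prod_cons]; nlinarith
    · rw [List.prod_cons]; nlinarith

/-- On the open cube the partial products `(xs.take (s₁+⋯+sᵢ)).prod` lie in `(0,1]`. [folklore] -/
theorem cumProd_pos_le_one (s : List ℕ) (xs : List ℝ) (hx : ∀ x ∈ xs, x ∈ Set.Ioo (0 : ℝ) 1)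
    (i : ℕ) : 0 < (xs.take (s.take i).sum).prod ∧ (xs.take (s.take i).sum).prod ≤ 1 :=
  let h := prod_pos_le_one_of_forall_mem_Ioo fun w hw => hx w (List.mem_of_mem_take hw)
  ⟨h.1, h.2.1⟩

/-- On the open cube, for an index with positive entries and coordinates of length `weight s`, the
partial products `(xs.take (s₁+⋯+sᵢ)).prod` with `1 ≤ i ≤ |s|` lie in `(0,1)`: they have at least
one factor. [folklore] -/
theorem cumProd_lt_one (s : List ℕ) (hs : ∀ i ∈ s, 1 ≤ i) (xs : List ℝ)
    (hxs : xs.length = weight s) (hx : ∀ x ∈ xs, x ∈ Set.Ioo (0 : ℝ) 1) {i : ℕ} (hi0 : i ≠ 0)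
    (hi : i ≤ s.length) : (xs.take (s.take i).sum).prod < 1 := by
  refine (prod_pos_le_one_of_forall_mem_Ioo fun w hw => hx w (List.mem_of_mem_take hw)).2.2 ?_
  rw [Ne, List.take_eq_nil_iff, not_or]
  have hlen : (s.take i).length = i := List.length_take_of_le hi
  have hsum := List.length_le_sum_of_one_le (s.take i) fun a ha => hs a (List.mem_of_mem_take ha)
  have hl := List.length_le_sum_of_one_le s hs
  change xs.length = s.sum at hxs
  constructor
  · omega
  · intro hnil
    rw [hnil, List.length_nil] at hxs
    omega

/-! ### The cube kernel identity -/

/-- **Stub `stub_kernelStuffle`: the cube kernel identity** (Soudères 2010 Prop. 1.5 / Markarian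
2020 Prop. 2).  Granted the endpoint count of the lattice paths and their last-step decomposition
up to permutation: for index lists with positive entries and coordinate lists of the right lengths
with entries in `(0,1)`,
`cubeKernel s xs · cubeKernel t ys = Σ_{p ∈ paths |s| |t|} pathKernel s t p xs ys`.
It is the instance `A i = (xs.take (s.take i).sum).prod`, `B j = (ys.take (t.take j).sum).prod` of
`kernel_identity_abstract` (by `cubeKernel_def`, `pathKernel_def`, `nodeProd_def`); the
non-degeneracy `A i · B j ≠ 1` off the origin holds because a partial product with at least one
factor lies in `(0,1)` and the other in `(0,1]`. [cite: Souderes2010, §1.3 Prop. 1.5] -/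
theorem stub_kernelStuffle :
    (∀ (k l : ℕ) (p : List Step), p ∈ paths k l → cx p = k ∧ cy p = l) →
    (∀ k l : ℕ, (paths (k + 1) (l + 1)).Perm
      ((paths k (l + 1)).map (· ++ [Step.X]) ++
        ((paths (k + 1) l).map (· ++ [Step.Y]) ++ (paths k l).map (· ++ [Step.D])))) →
    ∀ s t : List ℕ, (∀ i ∈ s, 1 ≤ i) → (∀ i ∈ t, 1 ≤ i) →
      ∀ xs ys : List ℝ, xs.length = weight s → ys.length = weight t →
        (∀ x ∈ xs, x ∈ Set.Ioo (0 : ℝ) 1) → (∀ y ∈ ys, y ∈ Set.Ioo (0 : ℝ) 1) →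
        cubeKernel s xs * cubeKernel t ys =
          ((paths s.length t.length).map fun p => pathKernel s t p xs ys).sum := by
  intro H1 H2 s t hs ht xs ys hxs hys hx hy
  have key := kernel_identity_abstract (fun i => (xs.take (s.take i).sum).prod)
    (fun j => (ys.take (t.take j).sum).prod) (fun p m => nodeProd s t p xs ys m)
    (fun p => pathKernel s t p xs ys) (fun p m => nodeProd_def s t p xs ys m)
    (fun p => pathKernel_def s t p xs ys) (by simp) (by simp) H1 H2 s.length t.length ?_
  · rw [cubeKernel_def, cubeKernel_def]
    exact key
  · rintro i j hi hj hij
    obtain ⟨hA0, hA1⟩ := cumProd_pos_le_one s xs hx i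
    obtain ⟨hB0, hB1⟩ := cumProd_pos_le_one t ys hy j
    apply ne_of_lt
    rcases hij with hi0 | hj0
    · exact mul_lt_one_of_nonneg_of_lt_one_left hA0.le (cumProd_lt_one s hs xs hxs hx hi0 hi) hB1
    · exact mul_lt_one_of_nonneg_of_lt_one_right hA1 hB0.le (cumProd_lt_one t ht ys hys hy hj0 hj)

end Summit.KontsevichZagierPeriods.FurushoPentagon.StuffleInKZ
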